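/-
Copyright: harness cell b2b-lgcu-borel (gen 16).  Honest framing: the VALUE here is a THEOREM
(all primes `p ≥ 59`, conditional on the named classical hypothesis `DicksonList` of
`DicksonReduction`) — NOT summit progress; the crux item `SubgroupIdentityDesigns`
(stmt-MatrixMultiplication-14079) stays open and untouched.
-/
import Mathlib
import Summits.MatrixMultiplication.MatrixMultiplication.Theorems.SubgroupIdentityDesigns.Negative.DicksonReduction
import Summits.MatrixMultiplication.MatrixMultiplication.Theorems.SubgroupIdentityDesigns.Negative.SingerCycleOrder

/-!
# Modulo Dickson, every surviving `(2,1)` witness is of "family I"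

Route `LevelGradedCohnUmans`, crux `SubgroupIdentityDesigns`, negative side, cell `(m,k) = (2,1)`,
the residual range `ε ∈ (0.98, 1]` left open by `DicksonReduction.no_levelOne_witness_of_dicksonList`.
Under `DicksonList p n` (Serre's Cartan-normaliser form of Dickson's classification, a named
hypothesis, NOT proved) and `p ≥ 59`, `0 < ε ≤ 1`, a subgroup-TPP triple `(H₁, H₂, H₃)` carrying a
level-one identity design and satisfying the level-one crux inequality is forced into the exact
shape that the order-profile sieve of ORACLE-g16 §G16-2 calls FAMILY I:

* `familyI_of_images_le` (UNCONDITIONAL, `p ≥ 7`) — if all three projective images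
  `Hᵢ Z/Z ≤ PGL₂(𝔽_p)` have order `≤ p + 1` then they have order EXACTLY `p + 1`, and the scalar
  parts `Sᵢ = Hᵢ ∩ Z` (pairwise coprime by the scalar law) have `|S₁| |S₂| |S₃| = p - 1` EXACTLY;
  `witness_familyI_of_dicksonList` (`p ≥ 59`, mod Dickson) — the image bounds hold, hence so does
  the conclusion;
* `not_conj_monomial_of_image_eq` (UNCONDITIONAL, `p ≥ 7`) — a subgroup conjugate into the
  monomial group `N(T_s)` never has projective image of order exactly `p + 1` (the image of
  `N(T_s)` has order `≤ 2p + 3` and contains the image of the diagonal torus `diagSubgroup`,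
  of order exactly `p - 1` (`card_diagSubgroup`, `card_image_diag`); `p + 1` and `p - 1` cannot
  both divide a number `≤ 2p + 3`);
* `witness_conj_singerNormal_of_dicksonList` (`p ≥ 61`) — hence every member of a surviving
  witness triple is conjugate into the normaliser `N(C)` of the Singer cycle: projectively a
  subgroup of order `p + 1` of the dihedral group `N(C)Z/Z` of order `2(p+1)` — exactly the
  FAMILY I of the order-profile sieve, now a theorem for all `p ≥ 61` modulo Dickson.

Proof of the first: the master floor (`LevelOneFloor`) gives `f(3) < V = |H₁||H₂||H₃|` (and
`DicksonReduction.image_le_of_dicksonList` bounds each image by `p + 1` under Dickson); with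
`|Hᵢ| ≤ |Sᵢ| · |Hᵢ Z/Z|` (`ImageCeiling.card_le_scalar_mul_card_image`) and `|S₁||S₂||S₃| ∣ p - 1`
(`ScalarLaw.scalar_law`), an image of order `≤ p` would give `V ≤ (p-1) p (p+1)² ≤ f(3)` and a
scalar product `< p - 1` (hence `≤ (p-1)/2`) would give `2V ≤ (p-1)(p+1)³ ≤ 2 f(3)` — both absurd.

Scope, honestly: conditional on `DicksonList`; says nothing for `p ≤ 58`; does not decide whether
family-I triples with a design exist (ORACLE-g16: none at `p = 61` by an exhaustive certificate
census; `p = 157, 181, 229, 241, …` open).  VALUE = THEOREM, NOT summit progress; the crux item is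
untouched and remains open.  Report: `run/shared/lean/b2b/levelgraded-cu/ORACLE-g16.md` §G16-1/6.
-/

set_option linter.dupNamespace false

noncomputable section

open scoped Classical
open Summit.MatrixMultiplication.MatrixMultiplication.Theorems.LieRankDesigns.Negative (GLm Mat budget)
open Literature.Barriers.MatrixMultiplication (SubgroupTPP)

namespace Summit.MatrixMultiplication.MatrixMultiplication.Theorems.SubgroupIdentityDesigns.Negative

section DicksonFamilyI

variable {p : ℕ} [hp : Fact p.Prime]

/-- **FAMILY I from image bounds** (`p ≥ 7`, `0 < ε ≤ 1`, unconditional): if all three members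
of a subgroup-TPP triple satisfying the level-one crux inequality have projective images of order
`≤ p + 1`, then the images have order EXACTLY `p + 1` and the scalar parts multiply to EXACTLY
`p - 1` (volume squeezed between the master floor `f(3)` and `(p-1)(p+1)³ = f(3) + 3p² + 3p`). -/
theorem familyI_of_images_le (hp7 : 7 ≤ p) {ε : ℝ} (hε : 0 < ε) (hε1 : ε ≤ 1)
    {H₁ H₂ H₃ : Subgroup (GLm p 2)} (htpp : SubgroupTPP H₁ H₂ H₃)
    (hwit : budget p 2 1 (2 + ε) <
      ((Nat.card H₁ * Nat.card H₂ * Nat.card H₃ : ℕ) : ℝ) ^ ((2 + ε) / 3))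
    (x₁ : Nat.card (H₁.map (QuotientGroup.mk' (scalarHom p 2).range)) ≤ p + 1)
    (x₂ : Nat.card (H₂.map (QuotientGroup.mk' (scalarHom p 2).range)) ≤ p + 1)
    (x₃ : Nat.card (H₃.map (QuotientGroup.mk' (scalarHom p 2).range)) ≤ p + 1) :
    Nat.card (H₁.map (QuotientGroup.mk' (scalarHom p 2).range)) = p + 1 ∧
    Nat.card (H₂.map (QuotientGroup.mk' (scalarHom p 2).range)) = p + 1 ∧
    Nat.card (H₃.map (QuotientGroup.mk' (scalarHom p 2).range)) = p + 1 ∧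
    Nat.card (H₁.comap (scalarHom p 2)) * Nat.card (H₂.comap (scalarHom p 2)) *
      Nat.card (H₃.comap (scalarHom p 2)) = p - 1 := by
  have hp1 : 1 ≤ p := by omega
  have hlowR : 1 + (p : ℝ) ^ 3 + ((p : ℝ) - 2) * ((p : ℝ) + 1) ^ 3 <
      ((Nat.card H₁ * Nat.card H₂ * Nat.card H₃ : ℕ) : ℝ) :=
    not_le.mp fun h => no_levelOne_witness_of_volume_le (by linarith) hε1 h hwit
  -- abbreviations
  set V := Nat.card H₁ * Nat.card H₂ * Nat.card H₃ with hV
  set X₁ := Nat.card (H₁.map (QuotientGroup.mk' (scalarHom p 2).range)) with hX₁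
  set X₂ := Nat.card (H₂.map (QuotientGroup.mk' (scalarHom p 2).range)) with hX₂
  set X₃ := Nat.card (H₃.map (QuotientGroup.mk' (scalarHom p 2).range)) with hX₃
  set S := Nat.card (H₁.comap (scalarHom p 2)) * Nat.card (H₂.comap (scalarHom p 2)) *
    Nat.card (H₃.comap (scalarHom p 2)) with hS
  have hSdvd : S ∣ p - 1 := (scalar_law htpp).2.2.2
  have hSle : S ≤ p - 1 := scalar_card_mul_le htpp
  have c₁ := card_le_scalar_mul_card_image H₁
  have c₂ := card_le_scalar_mul_card_image H₂
  have c₃ := card_le_scalar_mul_card_image H₃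
  -- V ≤ S · X₁ X₂ X₃
  have hVle : V ≤ S * (X₁ * X₂ * X₃) := by
    calc V ≤ (Nat.card (H₁.comap (scalarHom p 2)) * X₁) *
          (Nat.card (H₂.comap (scalarHom p 2)) * X₂) *
          (Nat.card (H₃.comap (scalarHom p 2)) * X₃) :=
          Nat.mul_le_mul (Nat.mul_le_mul c₁ c₂) c₃
      _ = S * (X₁ * X₂ * X₃) := by rw [hS]; ring
  have hp7R : (7 : ℝ) ≤ p := by exact_mod_cast hp7
  have hp0 : (0 : ℝ) ≤ p := by positivity
  have hpp : (7 : ℝ) * p ≤ (p : ℝ) * p := by nlinarith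
  -- every image has order exactly p + 1
  have key : ∀ {a b c : ℕ}, a ≤ p + 1 → b ≤ p + 1 → c ≤ p + 1 → V ≤ S * (a * b * c) →
      a = p + 1 := by
    intro a b c ha hb hc hVabc
    by_contra hne
    have ha' : a ≤ p := by omega
    have hVN : V ≤ (p - 1) * (p * (p + 1) * (p + 1)) :=
      hVabc.trans (Nat.mul_le_mul hSle (Nat.mul_le_mul (Nat.mul_le_mul ha' hb) hc))
    have hVR : ((V : ℕ) : ℝ) ≤ ((p : ℝ) - 1) * ((p : ℝ) * ((p : ℝ) + 1) * ((p : ℝ) + 1)) := by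
      have h := (Nat.cast_le (α := ℝ)).mpr hVN
      push_cast [Nat.cast_sub hp1] at h
      exact h
    nlinarith [hlowR, hVR, mul_nonneg (mul_nonneg hp0 hp0) (sub_nonneg.2 hp7R), hpp]
  have e₁ : X₁ = p + 1 := key x₁ x₂ x₃ hVle
  have e₂ : X₂ = p + 1 :=
    key x₂ x₁ x₃ (by rw [show X₂ * X₁ * X₃ = X₁ * X₂ * X₃ by ring]; exact hVle)
  have e₃ : X₃ = p + 1 :=
    key x₃ x₁ x₂ (by rw [show X₃ * X₁ * X₂ = X₁ * X₂ * X₃ by ring]; exact hVle)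
  refine ⟨e₁, e₂, e₃, ?_⟩
  -- the scalar product is exactly p - 1
  by_contra hSne
  have h2S : 2 * S ≤ p - 1 := two_mul_le_of_dvd_of_ne hSdvd hSne (by omega)
  have hVN : 2 * V ≤ (p - 1) * ((p + 1) * (p + 1) * (p + 1)) := by
    calc 2 * V ≤ 2 * (S * (X₁ * X₂ * X₃)) := Nat.mul_le_mul_left 2 hVle
      _ = (2 * S) * (X₁ * X₂ * X₃) := by ring
      _ ≤ (p - 1) * ((p + 1) * (p + 1) * (p + 1)) := by
          rw [e₁, e₂, e₃]; exact Nat.mul_le_mul_right _ h2S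
  have hVR : 2 * ((V : ℕ) : ℝ) ≤ ((p : ℝ) - 1) * (((p : ℝ) + 1) * ((p : ℝ) + 1) * ((p : ℝ) + 1)) := by
    have h := (Nat.cast_le (α := ℝ)).mpr hVN
    push_cast [Nat.cast_sub hp1] at h
    exact h
  nlinarith [hlowR, hVR, hpp, mul_nonneg (mul_nonneg hp0 hp0) (sub_nonneg.2 hp7R)]

/-- **Modulo Dickson, a surviving `(2,1)` witness is of family I** (`p ≥ 59`, `0 < ε ≤ 1`): all
three projective images have order exactly `p + 1` and the scalar parts multiply to exactly
`p - 1`. -/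
theorem witness_familyI_of_dicksonList (hp59 : 59 ≤ p) {n : ZMod p}
    (hn : ∀ x : ZMod p, x * x ≠ n) (hD : DicksonList p n)
    {ε : ℝ} (hε : 0 < ε) (hε1 : ε ≤ 1)
    {H₁ H₂ H₃ : Subgroup (GLm p 2)} (htpp : SubgroupTPP H₁ H₂ H₃)
    (hdesign : ∃ c : Mat p 2 → ℂ, (∀ M, 1 < M.rank → c M = 0) ∧
      (∑ M, c M * ZMod.stdAddChar (Matrix.trace (M * ((1 : GLm p 2) : Mat p 2)))) = 1 ∧
      ∀ a ∈ H₁, ∀ b ∈ H₂, ∀ g ∈ H₃, a * b * g ≠ 1 →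
        (∑ M, c M *
          ZMod.stdAddChar (Matrix.trace (M * ((a * b * g : GLm p 2) : Mat p 2)))) = 0)
    (hwit : budget p 2 1 (2 + ε) <
      ((Nat.card H₁ * Nat.card H₂ * Nat.card H₃ : ℕ) : ℝ) ^ ((2 + ε) / 3)) :
    Nat.card (H₁.map (QuotientGroup.mk' (scalarHom p 2).range)) = p + 1 ∧
    Nat.card (H₂.map (QuotientGroup.mk' (scalarHom p 2).range)) = p + 1 ∧
    Nat.card (H₃.map (QuotientGroup.mk' (scalarHom p 2).range)) = p + 1 ∧
    Nat.card (H₁.comap (scalarHom p 2)) * Nat.card (H₂.comap (scalarHom p 2)) *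
      Nat.card (H₃.comap (scalarHom p 2)) = p - 1 := by
  have hp3 : 3 ≤ p := by omega
  obtain ⟨-, pf₁, pf₂, pf₃⟩ := levelOne_witness_pfree_profile hp3 hε hε1 htpp hdesign hwit
  obtain ⟨fv₁, fv₂, fv₃⟩ := levelOne_witness_free_vector hp3 hε hε1 htpp hdesign hwit
  exact familyI_of_images_le (by omega) hε hε1 htpp hwit (image_le_of_dicksonList hp59 hn hD pf₁ fv₁)
    (image_le_of_dicksonList hp59 hn hD pf₂ fv₂) (image_le_of_dicksonList hp59 hn hD pf₃ fv₃)

/-! ## The diagonal torus, and the exclusion of the monomial branch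

For `p ≥ 7` a `p`-regular subgroup with projective image of order exactly `p + 1` is NOT conjugate
into the monomial group `N(T_s)`: the image `N(T_s)Z/Z` has order `≤ 2p²/(p-1) ≤ 2p + 3` and
contains the image of the diagonal torus, of order exactly `p - 1`; an image of order `p + 1`
inside it would make `p + 1` and `p - 1` both divide a number `≤ 2p + 3` — impossible for `p ≥ 7`.
Hence, modulo Dickson, every member of a surviving witness triple is conjugate into the normaliser
`N(C)` of the Singer cycle (`witness_conj_singerNormal_of_dicksonList`). -/

/-- `g` is DIAGONAL. -/
def IsDiag (g : GLm p 2) : Prop := (g : Mat p 2) 0 1 = 0 ∧ (g : Mat p 2) 1 0 = 0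

/-- `1` is diagonal. -/
theorem isDiag_one : IsDiag (1 : GLm p 2) := ⟨gl2_one_apply.2.1, gl2_one_apply.2.2.1⟩

/-- Products of diagonal matrices are diagonal. -/
theorem isDiag_mul {g h : GLm p 2} (hg : IsDiag g) (hh : IsDiag h) : IsDiag (g * h) := by
  obtain ⟨g01, g10⟩ := hg
  obtain ⟨h01, h10⟩ := hh
  constructor <;> rw [gl2_mul_apply] <;> simp [g01, g10, h01, h10]

/-- The DIAGONAL TORUS `T_s ≤ GL₂(𝔽_p)`. -/
def diagSubgroup (p : ℕ) [Fact p.Prime] : Subgroup (GLm p 2) :=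
  subgroupOfMulClosed {g : GLm p 2 | IsDiag g} isDiag_one (fun _ hx _ hy => isDiag_mul hx hy)

/-- Membership in the diagonal torus is the entry condition. -/
theorem mem_diagSubgroup {g : GLm p 2} :
    g ∈ diagSubgroup p ↔ (g : Mat p 2) 0 1 = 0 ∧ (g : Mat p 2) 1 0 = 0 :=
  Iff.rfl

/-- The diagonal torus lies in the monomial group. -/
theorem diagSubgroup_le_monomial : diagSubgroup p ≤ monomialSubgroup p := by
  intro g hg
  rw [mem_monomialSubgroup]
  exact Or.inl (mem_diagSubgroup.mp hg)

/-- Scalars are diagonal. -/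
theorem range_scalarHom_le_diag : (scalarHom p 2).range ≤ diagSubgroup p := by
  rintro _ ⟨u, rfl⟩
  rw [mem_diagSubgroup]
  constructor <;> simp [coe_scalarHom, Matrix.scalar_apply]

/-- The diagonal entries of a diagonal invertible matrix are non-zero. -/
theorem diag_entries_ne_zero {g : GLm p 2} (hg : g ∈ diagSubgroup p) :
    (g : Mat p 2) 0 0 ≠ 0 ∧ (g : Mat p 2) 1 1 ≠ 0 :=
  ⟨fun h => row_ne_zero g 0 ⟨h, (mem_diagSubgroup.mp hg).1⟩,
    fun h => row_ne_zero g 1 ⟨(mem_diagSubgroup.mp hg).2, h⟩⟩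

/-- `|T_s| = (p-1)²` (the diagonal entries give a bijection with `𝔽_pˣ × 𝔽_pˣ`). -/
theorem card_diagSubgroup : Nat.card (diagSubgroup p) = (p - 1) ^ 2 := by
  have hc : Nat.card ((ZMod p)ˣ × (ZMod p)ˣ) = (p - 1) ^ 2 := by
    rw [Nat.card_prod, Nat.card_eq_fintype_card, ZMod.card_units]; ring
  rw [← hc]
  let f : diagSubgroup p → (ZMod p)ˣ × (ZMod p)ˣ := fun g =>
    (Units.mk0 (((g : GLm p 2) : Mat p 2) 0 0) (diag_entries_ne_zero g.2).1,
      Units.mk0 (((g : GLm p 2) : Mat p 2) 1 1) (diag_entries_ne_zero g.2).2)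
  refine Nat.card_eq_of_bijective f ⟨?_, ?_⟩
  · intro x y hxy
    simp only [f, Prod.mk.injEq, Units.mk0_inj] at hxy
    have hx := mem_diagSubgroup.mp x.2
    have hy := mem_diagSubgroup.mp y.2
    exact Subtype.ext (gl2_ext hxy.1 (by rw [hx.1, hy.1]) (by rw [hx.2, hy.2]) hxy.2)
  · rintro ⟨u, v⟩
    obtain ⟨g, h00, h01, h10, h11⟩ := exists_gl2 (u : ZMod p) 0 0 (v : ZMod p)
      (by rw [mul_zero, sub_zero]; exact mul_ne_zero u.ne_zero v.ne_zero)
    refine ⟨⟨g, mem_diagSubgroup.mpr ⟨h01, h10⟩⟩, ?_⟩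
    exact Prod.ext (Units.ext (by simp [f, h00])) (Units.ext (by simp [f, h11]))

/-- `|T_s Z/Z| = p - 1` (`p ≥ 3`). -/
theorem card_image_diag (hp3 : 3 ≤ p) :
    Nat.card ((diagSubgroup p).map (QuotientGroup.mk' (scalarHom p 2).range)) = p - 1 := by
  apply le_antisymm
  · have h := card_map_mk_le_div (le_refl (diagSubgroup p)) range_scalarHom_le_diag
    rw [card_diagSubgroup] at h
    calc _ ≤ (p - 1) ^ 2 / (p - 1) := h
      _ = p - 1 := by rw [sq, Nat.mul_div_cancel _ (by omega : 0 < p - 1)]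
  · have h := card_le_scalar_mul_card_image (diagSubgroup p)
    rw [card_diagSubgroup] at h
    have hS : Nat.card ((diagSubgroup p).comap (scalarHom p 2)) ≤ p - 1 :=
      Nat.le_of_dvd (by omega) (card_subgroup_units_dvd _)
    have h' : (p - 1) * (p - 1) ≤
        (p - 1) * Nat.card ((diagSubgroup p).map (QuotientGroup.mk' (scalarHom p 2).range)) := by
      rw [← sq]; exact h.trans (Nat.mul_le_mul_right _ hS)
    exact Nat.le_of_mul_le_mul_left h' (by omega)

/-- `|N(T_s) Z/Z| ≤ 2p + 3` (`p ≥ 3`; the true order is `2(p-1)`). -/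
theorem card_image_monomial_le (hp3 : 3 ≤ p) :
    Nat.card ((monomialSubgroup p).map (QuotientGroup.mk' (scalarHom p 2).range)) ≤
      2 * p + 3 := by
  have h := card_map_mk_le_div (le_refl (monomialSubgroup p)) range_scalarHom_le_monomial
  refine h.trans ((Nat.div_le_div_right card_monomialSubgroup_le).trans
    (Nat.div_le_of_le_mul ?_))
  obtain ⟨q, hq⟩ : ∃ q, p = q + 1 := ⟨p - 1, by omega⟩
  have hq2 : 2 ≤ q := by omega
  rw [hq, Nat.add_sub_cancel]
  nlinarith

/-- **The monomial branch is impossible** (`p ≥ 7`): a subgroup conjugate into `N(T_s)` cannot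
have projective image of order exactly `p + 1`. -/
theorem not_conj_monomial_of_image_eq (hp7 : 7 ≤ p) {H : Subgroup (GLm p 2)} {g : GLm p 2}
    (hg : ∀ x ∈ H, IsMonomial (g * x * g⁻¹))
    (hX : Nat.card (H.map (QuotientGroup.mk' (scalarHom p 2).range)) = p + 1) : False := by
  have hp3 : 3 ≤ p := by omega
  have hle : H.map (MulAut.conj g).toMonoidHom ≤ monomialSubgroup p := by
    intro y hy
    have hy' := mem_map_conj_iff'.mp hy
    have e : y = g * (g⁻¹ * y * g) * g⁻¹ := by group
    rw [mem_monomialSubgroup]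
    have hm := hg _ hy'
    rw [← e] at hm
    exact hm
  have hX' : Nat.card ((H.map (MulAut.conj g).toMonoidHom).map
      (QuotientGroup.mk' (scalarHom p 2).range)) = p + 1 := by
    rw [card_image_conj]; exact hX
  have hdvd1 : p + 1 ∣
      Nat.card ((monomialSubgroup p).map (QuotientGroup.mk' (scalarHom p 2).range)) :=
    hX' ▸ Subgroup.card_dvd_of_le (Subgroup.map_mono hle)
  have hdvd2 : p - 1 ∣
      Nat.card ((monomialSubgroup p).map (QuotientGroup.mk' (scalarHom p 2).range)) :=
    card_image_diag hp3 ▸ Subgroup.card_dvd_of_le (Subgroup.map_mono diagSubgroup_le_monomial)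
  have ha := card_image_monomial_le hp3
  set a := Nat.card ((monomialSubgroup p).map (QuotientGroup.mk' (scalarHom p 2).range))
    with ha_def
  obtain ⟨k, hk⟩ := hdvd1
  have hk2 : k ≤ 2 := by
    by_contra hk3
    have h3 : 3 ≤ k := by omega
    have : (p + 1) * 3 ≤ a := hk ▸ Nat.mul_le_mul_left _ h3
    omega
  interval_cases k
  · rw [mul_zero] at hk
    have : 0 < a := Nat.card_pos
    omega
  · rw [mul_one] at hk
    have e : p + 1 = (p - 1) + 2 := by omega
    rw [hk, e] at hdvd2
    have h2 : p - 1 ∣ 2 := (Nat.dvd_add_right dvd_rfl).mp hdvd2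
    have := Nat.le_of_dvd two_pos h2
    omega
  · have e : (p + 1) * 2 = (p - 1) * 2 + 4 := by omega
    rw [hk, e] at hdvd2
    have h2 : p - 1 ∣ 4 := (Nat.dvd_add_right (dvd_mul_right (p - 1) 2)).mp hdvd2
    have := Nat.le_of_dvd (by norm_num) h2
    omega

/-- **Modulo Dickson, every member of a surviving `(2,1)` witness is conjugate into the normaliser
`N(C)` of the Singer cycle** (`p ≥ 61`, `0 < ε ≤ 1`; with `witness_familyI_of_dicksonList`: image of
order exactly `p + 1`, scalar parts multiplying to `p - 1` — the FAMILY I of the sieve). -/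
theorem witness_conj_singerNormal_of_dicksonList (hp61 : 61 ≤ p) {n : ZMod p}
    (hn : ∀ x : ZMod p, x * x ≠ n) (hD : DicksonList p n)
    {ε : ℝ} (hε : 0 < ε) (hε1 : ε ≤ 1)
    {H₁ H₂ H₃ : Subgroup (GLm p 2)} (htpp : SubgroupTPP H₁ H₂ H₃)
    (hdesign : ∃ c : Mat p 2 → ℂ, (∀ M, 1 < M.rank → c M = 0) ∧
      (∑ M, c M * ZMod.stdAddChar (Matrix.trace (M * ((1 : GLm p 2) : Mat p 2)))) = 1 ∧
      ∀ a ∈ H₁, ∀ b ∈ H₂, ∀ g ∈ H₃, a * b * g ≠ 1 →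
        (∑ M, c M *
          ZMod.stdAddChar (Matrix.trace (M * ((a * b * g : GLm p 2) : Mat p 2)))) = 0)
    (hwit : budget p 2 1 (2 + ε) <
      ((Nat.card H₁ * Nat.card H₂ * Nat.card H₃ : ℕ) : ℝ) ^ ((2 + ε) / 3)) :
    (∃ g : GLm p 2, ∀ x ∈ H₁, IsSingerNormal n (g * x * g⁻¹)) ∧
    (∃ g : GLm p 2, ∀ x ∈ H₂, IsSingerNormal n (g * x * g⁻¹)) ∧
    (∃ g : GLm p 2, ∀ x ∈ H₃, IsSingerNormal n (g * x * g⁻¹)) := by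
  have hp59 : 59 ≤ p := by omega
  have hp7 : 7 ≤ p := by omega
  have hp3 : 3 ≤ p := by omega
  obtain ⟨e₁, e₂, e₃, -⟩ := witness_familyI_of_dicksonList hp59 hn hD hε hε1 htpp hdesign hwit
  obtain ⟨-, pf₁, pf₂, pf₃⟩ := levelOne_witness_pfree_profile hp3 hε hε1 htpp hdesign hwit
  have key : ∀ {H : Subgroup (GLm p 2)}, ¬ p ∣ Nat.card H →
      Nat.card (H.map (QuotientGroup.mk' (scalarHom p 2).range)) = p + 1 →
      ∃ g : GLm p 2, ∀ x ∈ H, IsSingerNormal n (g * x * g⁻¹) := by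
    intro H hpf hX
    rcases hD H hpf with ⟨g, hg⟩ | hs | hsmall
    · exact (not_conj_monomial_of_image_eq hp7 hg hX).elim
    · exact hs
    · omega
  exact ⟨key pf₁ e₁, key pf₂ e₂, key pf₃ e₃⟩

end DicksonFamilyI

end Summit.MatrixMultiplication.MatrixMultiplication.Theorems.SubgroupIdentityDesigns.Negative

end
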